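import Summits.CriticalPhenomena.PercolationContinuityZ3.Theorems.Transplant.FKConnectivityAllQAntipodalX2WordsInvolution
import Summits.CriticalPhenomena.PercolationContinuityZ3.Theorems.Transplant.FKConnectivityAllQAntipodalX2WordsSolitonPairs
import HarnessLib

/-!
# Connectivity correlation inequalities for `φ_{w,q}` — the TYPE-WORD MODEL of `X2`, file 10: THEOREM A and WORD-HALL on type
# words (memo g13 §2–§4, §1.2–1.3)

Helper file (`--supports stmt-CriticalPhenomena-4575`), FK sub-lane `prim-bschramm-fk-2` (gen 13); builds on p205010 (kernel
theorem, internal audit signed; external expert review pending).  Pure finite combinatorics on the type-word model of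
`…AntipodalX2Words` (memo `bschramm/FROM-fk-2-g13-WORD-HALL.md`).
MAIN RESULTS.
* `eq_solitonPattern_of_rowA_nil` / `_of_rowB_nil` (converse trichotomy): a word whose hull part has an empty row is a soliton word.
* **`theoremA`**: for EVERY loser `x`, the partner `ι x` of RULE N ("nearest balanced window + soliton shift") is a loser of the same
  level with the same window; `iota_iota`: `ι` is an involution on losers; `ruleN_window_hull`: the window contains the hull.
* **`wordHall_type`**: `Φ x := (ι x).map swap` maps losers to WINNERS of the same level, injectively, changing `x` only by turning
  ground blocks outside the window into flipped ones — the solution of gen 12's word problem (memo g12 §4.2, g13 Theorem A) at the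
  level of type words.  Machine-checked independently for all type words with `≤ 17` blocks (kit j129422, 7.3·10⁷ losers) and
  end-to-end in the σ-word model for all spine shapes of length `≤ 9` (kit j129420/j129421).
What is NOT here: the lift from type words to gen 12's σ-words (blocks, multiplicities — memo g13 §1.3) and the summation argument
turning WORD-HALL into `apX2 ≥ 0` (`FK.ApX2Pos`, memo g13 §5) — files F4/F5 of the memo's plan.
[cite: Grimmett2006, §3.9 (p. 63)]
-/

namespace Summit.CriticalPhenomena.PercolationContinuityZ3.Theorems

namespace FK

namespace X2Word

/-! ### The converse trichotomy: a hull part with an empty row is a soliton train -/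

section Converse

variable {k₀ : Kind} {x : List Ty} {h h' : ℕ}

/-- If row `A` of the hull part is empty, the word is a `W`-soliton word. [folklore] -/
theorem eq_solitonPattern_of_rowA_nil (hs : hullStart x = some h) (he : hullEnd x = some h')
    (hA : rowA (kindAt k₀ h) ((x.drop h).take (h' + 1 - h)) = []) :
    kindAt k₀ h = .W ∧ h' = h + 2 * ((h' - h) / 2) ∧ x = solitonPattern x.length h ((h' - h) / 2) := by
  obtain ⟨hh, hx1, hx2⟩ := (hullStart_eq_some_iff x h).mp hs
  obtain ⟨hh', hx1', hx2'⟩ := (hullEnd_eq_some_iff x h').mp he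
  obtain ⟨hle, -, -⟩ := hull_decomp hs he
  obtain ⟨d, rfl⟩ : ∃ d, h' = h + d := ⟨h' - h, by omega⟩
  rw [rowA_eq_nil_iff] at hA
  have hlen : ((x.drop h).take (h + d + 1 - h)).length = d + 1 := by simp; omega
  -- entries of the hull part are entries of x
  have hget : ∀ (j : ℕ) (hj : j < d + 1), visA (kindAt (kindAt k₀ h) j) (x[h + j]'(by omega)) = false := by
    intro j hj
    have := hA j (by rw [hlen]; exact hj)
    simpa [List.getElem_take, List.getElem_drop] using this
  -- the kind of block h
  have hk : kindAt k₀ h = .W := by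
    have h0 := hget 0 (by omega)
    simp only [kindAt_zero, Nat.add_zero] at h0
    cases hq : kindAt k₀ h with
    | W => rfl
    | P => rw [hq] at h0; simp [visA] at h0; exact absurd h0 hx1
  rw [hk] at hget
  -- parity structure: even offsets are F, odd offsets are E
  have hval : ∀ (j : ℕ) (hj : j < d + 1), x[h + j]'(by omega) = if j % 2 = 0 then .F else .E := by
    intro j hj
    have h0 := hget j hj
    rw [kindAt_eq_of_mod] at h0
    by_cases hp : j % 2 = 0
    · simp only [hp, if_true] at h0 ⊢
      revert h0; cases x[h + j] <;> simp [visA]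
    · simp only [hp, if_false, Kind.other_W] at h0 ⊢
      revert h0; cases x[h + j] <;> simp [visA]
  have hpar : d % 2 = 0 := by
    by_contra hp
    have := hval d (by omega)
    rw [if_neg hp] at this
    exact hx1' this
  have hd : h + d - h = d := by omega
  rw [hd]
  refine ⟨hk, by omega, ?_⟩
  apply List.ext_getElem (by simp)
  intro j hj1 hj2
  rw [getElem_solitonPattern]
  by_cases hjl : j < h
  · rw [hx2 j hjl]; simp; omega
  · by_cases hjr : h + d < j
    · rw [hx2' j hj1 hjr]; simp; omega
    · obtain ⟨i, rfl⟩ : ∃ i, j = h + i := ⟨j - h, by omega⟩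
      rw [hval i (by omega)]
      by_cases hp : i % 2 = 0
      · simp [hp]; omega
      · simp [hp]

/-- If row `B` of the hull part is empty, the word is a `P`-soliton word. [folklore] -/
theorem eq_solitonPattern_of_rowB_nil (hs : hullStart x = some h) (he : hullEnd x = some h')
    (hB : rowB (kindAt k₀ h) ((x.drop h).take (h' + 1 - h)) = []) :
    kindAt k₀ h = .P ∧ h' = h + 2 * ((h' - h) / 2) ∧ x = solitonPattern x.length h ((h' - h) / 2) := by
  obtain ⟨hh, hx1, hx2⟩ := (hullStart_eq_some_iff x h).mp hs
  obtain ⟨hh', hx1', hx2'⟩ := (hullEnd_eq_some_iff x h').mp he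
  obtain ⟨hle, -, -⟩ := hull_decomp hs he
  obtain ⟨d, rfl⟩ : ∃ d, h' = h + d := ⟨h' - h, by omega⟩
  rw [rowB_eq_nil_iff] at hB
  have hlen : ((x.drop h).take (h + d + 1 - h)).length = d + 1 := by simp; omega
  -- entries of the hull part are entries of x
  have hget : ∀ (j : ℕ) (hj : j < d + 1), visB (kindAt (kindAt k₀ h) j) (x[h + j]'(by omega)) = false := by
    intro j hj
    have := hB j (by rw [hlen]; exact hj)
    simpa [List.getElem_take, List.getElem_drop] using this
  -- the kind of block h
  have hk : kindAt k₀ h = .P := by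
    have h0 := hget 0 (by omega)
    simp only [kindAt_zero, Nat.add_zero] at h0
    cases hq : kindAt k₀ h with
    | P => rfl
    | W => rw [hq] at h0; simp [visB] at h0; exact absurd h0 hx1
  rw [hk] at hget
  -- parity structure: even offsets are F, odd offsets are E
  have hval : ∀ (j : ℕ) (hj : j < d + 1), x[h + j]'(by omega) = if j % 2 = 0 then .F else .E := by
    intro j hj
    have h0 := hget j hj
    rw [kindAt_eq_of_mod] at h0
    by_cases hp : j % 2 = 0
    · simp only [hp, if_true] at h0 ⊢
      revert h0; cases x[h + j] <;> simp [visB]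
    · simp only [hp, if_false, Kind.other_P] at h0 ⊢
      revert h0; cases x[h + j] <;> simp [visB]
  have hpar : d % 2 = 0 := by
    by_contra hp
    have := hval d (by omega)
    rw [if_neg hp] at this
    exact hx1' this
  have hd : h + d - h = d := by omega
  rw [hd]
  refine ⟨hk, by omega, ?_⟩
  apply List.ext_getElem (by simp)
  intro j hj1 hj2
  rw [getElem_solitonPattern]
  by_cases hjl : j < h
  · rw [hx2 j hjl]; simp; omega
  · by_cases hjr : h + d < j
    · rw [hx2' j hj1 hjr]; simp; omega
    · obtain ⟨i, rfl⟩ : ∃ i, j = h + i := ⟨j - h, by omega⟩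
      rw [hval i (by omega)]
      by_cases hp : i % 2 = 0
      · simp [hp]; omega
      · simp [hp]

end Converse

/-! ### THEOREM A (memo g13 §2–4): RULE N is a valid involution on all losers -/

section TheoremA

/-- **THEOREM A (memo `bschramm/FROM-fk-2-g13-WORD-HALL.md`, §2–§4).**  For every type word `x` that is a loser (block `0` of kind
`k₀`), the partner `ι x` of RULE N is a loser of the same level with the same window: `ruleN (ι x) = ruleN x`.  Cases: ground word
(`ground_pair_W`, `ground_fixed_P`), soliton words (`soliton_pair_*`, via the converse trichotomy `eq_solitonPattern_of_row?_nil`),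
generic words (`iota_generic_valid`, `ruleN_iota_generic`). [folklore] -/
theorem theoremA (k₀ : Kind) (x : List Ty) (hx : isLoser k₀ x = true) :
    isLoser k₀ (iota k₀ x) = true ∧ level k₀ (iota k₀ x) = level k₀ x ∧ ruleN k₀ (iota k₀ x) = ruleN k₀ x := by
  cases hs : hullStart x with
  | none =>
    -- the ground word
    have hxE : x = List.replicate x.length .E := eq_replicate_of_allE ((hullStart_eq_none_iff x).mp hs)
    generalize hn : x.length = n at hxE
    subst hxE
    cases k₀ with
    | P => rw [ground_fixed_P]; exact ⟨hx, rfl, rfl⟩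
    | W =>
      have hn2 : 1 < n := by
        rw [(ground_loser_level .W n).1] at hx
        simp at hx; omega
      obtain ⟨h1, h2, h3, h4⟩ := ground_pair_W hn2
      rw [h1]; exact ⟨h2, h3, h4⟩
  | some h =>
    obtain ⟨h', he⟩ : ∃ h', hullEnd x = some h' := by
      cases hq : hullEnd x with
      | some h' => exact ⟨h', rfl⟩
      | none =>
        exfalso
        have h1 := (hullEnd_eq_none_iff x).mp hq
        rw [← hullStart_eq_none_iff] at h1
        rw [h1] at hs; exact absurd hs (by simp)
    obtain ⟨hle, hh', -⟩ := hull_decomp hs he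
    by_cases hA : rowA (kindAt k₀ h) ((x.drop h).take (h' + 1 - h)) = []
    · -- a W-soliton word
      obtain ⟨hk, hh2, hxp⟩ := eq_solitonPattern_of_rowA_nil hs he hA
      generalize hm : (h' - h) / 2 = m at hh2 hxp
      generalize hn : x.length = n at hxp hh'
      subst hxp
      obtain ⟨hl0, -⟩ := soliton_W_loser_level (k₀ := k₀) (show h + 2 * m < n by omega) hk
      rw [hl0] at hx; simp at hx
      rcases Nat.lt_or_ge h 1 with h0 | h0
      · have h00 : h = 0 := by omega
        subst h00
        have hk0 : k₀ = .W := hk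
        rcases Nat.lt_or_ge m 1 with hm0 | hm0
        · have hm00 : m = 0 := by omega
          subst hm00
          obtain ⟨h1, h2, h3, h4⟩ := soliton_pair_W_zero_zero (n := n) hk0 (by omega)
          rw [h1]; exact ⟨h2, h3, h4⟩
        · obtain ⟨h1, h2, h3, h4⟩ := soliton_pair_W_zero (n := n) hk0 hm0 (by omega)
          rw [h1]; exact ⟨h2, h3, h4⟩
      · obtain ⟨h1, h2, h3, h4⟩ := soliton_pair_W_pos (n := n) hk h0 hx
        rw [h1]; exact ⟨h2, h3, h4⟩
    · by_cases hB : rowB (kindAt k₀ h) ((x.drop h).take (h' + 1 - h)) = []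
      · -- a P-soliton word
        obtain ⟨hk, hh2, hxp⟩ := eq_solitonPattern_of_rowB_nil hs he hB
        generalize hm : (h' - h) / 2 = m at hh2 hxp
        generalize hn : x.length = n at hxp hh'
        subst hxp
        obtain ⟨hl0, -⟩ := soliton_P_loser_level (k₀ := k₀) (show h + 2 * m < n by omega) hk
        rw [hl0] at hx; simp only [decide_eq_true_eq] at hx
        obtain ⟨h1le, hor⟩ := hx
        rcases Nat.lt_or_ge h 2 with h2 | h2
        · have h11 : h = 1 := by omega
          subst h11
          have hk0 : k₀ = .W := by
            cases k₀ with
            | W => rfl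
            | P => exact absurd hk (by decide)
          have hlos : 2 * m + 3 < n := by rcases hor with hor | hor <;> omega
          obtain ⟨h1, h2', h3, h4⟩ := soliton_pair_P_one (n := n) (m := m) hk0 hlos
          rw [h1]; exact ⟨h2', h3, h4⟩
        · obtain ⟨h1, h2', h3, h4⟩ := soliton_pair_P_ge2 (n := n) (m := m) hk h2 (by omega)
          rw [h1]; exact ⟨h2', h3, h4⟩
      · -- a generic word
        obtain ⟨h1, h2⟩ := iota_generic_valid hx hs he hA hB
        exact ⟨h1, h2, ruleN_iota_generic hx hs he rfl hA hB⟩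

/-- RULE N is an INVOLUTION on losers. [folklore] -/
theorem iota_iota (k₀ : Kind) (x : List Ty) (hx : isLoser k₀ x = true) : iota k₀ (iota k₀ x) = x := by
  obtain ⟨-, -, hr⟩ := theoremA k₀ x hx
  unfold iota at hr ⊢
  -- unfold the outer iota using the window of x
  cases hq : ruleN k₀ x with
  | none => simp only [hq]
  | some st =>
    obtain ⟨s, t⟩ := st
    simp only [hq] at hr ⊢
    rw [hr]
    exact swapWin_swapWin s t x

/-- The window of RULE N contains the hull. [folklore] -/
theorem ruleN_window_hull {k₀ : Kind} {x : List Ty} {h h' s t : ℕ} (hs : hullStart x = some h) (he : hullEnd x = some h')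
    (hr : ruleN k₀ x = some (s, t)) : s ≤ h ∧ h' ≤ t := by
  obtain ⟨hle, -, -⟩ := hull_decomp hs he
  unfold ruleN at hr
  rw [hs, he] at hr
  simp only at hr
  by_cases hsol : isSoliton k₀ x (kindAt k₀ h) h ((h' - h) / 2) = true
  · -- soliton branch: the hull end is h + 2m
    rw [if_pos hsol] at hr
    simp only [Option.some.injEq] at hr
    unfold isSoliton at hsol
    simp only [Bool.and_eq_true, decide_eq_true_eq] at hsol
    obtain ⟨⟨-, hlt⟩, hpat⟩ := hsol
    have hend : h' ≤ h + 2 * ((h' - h) / 2) := by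
      by_contra hc
      obtain ⟨_, hne, _⟩ := (hullEnd_eq_some_iff x h').mp he
      apply hne
      rw [List.getElem_of_eq hpat, getElem_solitonPattern]
      simp only [ite_eq_right_iff]
      intro hh; omega
    revert hr
    generalize (h' - h) / 2 = m at hend
    unfold solitonWindow
    cases kindAt k₀ h <;> simp only <;> split_ifs <;> simp only [Prod.mk.injEq] <;> rintro ⟨rfl, rfl⟩ <;> omega
  · rw [if_neg hsol] at hr
    simp only [Option.some.injEq, Prod.mk.injEq] at hr
    obtain ⟨hs', ht'⟩ := hr
    constructor
    · rw [← hs']; split_ifs <;> omega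
    · rw [← ht']; split_ifs <;> omega

/-- **WORD-HALL on type words (memo g13 §1.2–1.3).**  `Φ x := (ι x).map swap` sends losers to WINNERS of the same level, injectively,
and changes `x` only by turning ground blocks outside the window into fully flipped blocks (`Φ x ≥ x` letterwise). [folklore] -/
theorem wordHall_type (k₀ : Kind) (x : List Ty) (hx : isLoser k₀ x = true) :
    isWinner k₀ ((iota k₀ x).map Ty.swap) = true ∧ level k₀ ((iota k₀ x).map Ty.swap) = level k₀ x ∧
    (∀ y, isLoser k₀ y = true → (iota k₀ y).map Ty.swap = (iota k₀ x).map Ty.swap → y = x) ∧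
    (∀ (j : ℕ) (hj : j < x.length) (hj' : j < ((iota k₀ x).map Ty.swap).length),
      ((iota k₀ x).map Ty.swap)[j] = x[j] ∨ (x[j] = .E ∧ ((iota k₀ x).map Ty.swap)[j] = .F)) := by
  obtain ⟨hl, hv, hr⟩ := theoremA k₀ x hx
  refine ⟨by rw [isWinner_map_swap]; exact hl, by rw [level_map_swap]; exact hv, ?_, ?_⟩
  · intro y hy hyx
    have : iota k₀ y = iota k₀ x := by
      have := congrArg (List.map Ty.swap) hyx
      simpa [List.map_map, Function.comp_def] using this
    rw [← iota_iota k₀ y hy, this, iota_iota k₀ x hx]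
  · intro j hj hj'
    -- inside the window the letter is unchanged, outside it was ground and becomes F
    cases hq : ruleN k₀ x with
    | none =>
      -- fixed point: the ground word with k₀ = P
      have hι : iota k₀ x = x := by unfold iota; rw [hq]
      have hsn : hullStart x = none := by
        unfold ruleN at hq
        cases hs' : hullStart x with
        | none => rfl
        | some h =>
          cases he' : hullEnd x with
          | some h' => rw [hs', he'] at hq; simp only at hq; split_ifs at hq
          | none =>
            exfalso
            have h1 := (hullEnd_eq_none_iff x).mp he'
            rw [← hullStart_eq_none_iff] at h1; rw [h1] at hs'; exact absurd hs' (by simp)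
      have hxj : x[j] = .E := (hullStart_eq_none_iff x).mp hsn _ (List.getElem_mem hj)
      right
      refine ⟨hxj, ?_⟩
      simp only [List.getElem_map, hι, hxj]; rfl
    | some st =>
      obtain ⟨s, t⟩ := st
      have hι : iota k₀ x = swapWin s t x := by unfold iota; rw [hq]
      simp only [List.getElem_map, hι, getElem_swapWin]
      by_cases hw : s ≤ j ∧ j ≤ t
      · left; rw [if_pos hw, Ty.swap_swap]
      · right
        rw [if_neg hw]
        -- outside the window: x[j] is ground
        have hxj : x[j] = .E := by
          cases hs' : hullStart x with
          | none => exact (hullStart_eq_none_iff x).mp hs' _ (List.getElem_mem hj)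
          | some h =>
            cases he' : hullEnd x with
            | none =>
              exfalso
              have h1 := (hullEnd_eq_none_iff x).mp he'
              rw [← hullStart_eq_none_iff] at h1; rw [h1] at hs'; exact absurd hs' (by simp)
            | some h' =>
              obtain ⟨h1, h2⟩ := ruleN_window_hull hs' he' hq
              obtain ⟨_, _, hx2⟩ := (hullStart_eq_some_iff x h).mp hs'
              obtain ⟨_, _, hx2'⟩ := (hullEnd_eq_some_iff x h').mp he'
              rcases not_and_or.mp hw with hw | hw
              · exact hx2 j (by omega)
              · exact hx2' j hj (by omega)
        rw [hxj]; exact ⟨rfl, rfl⟩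

end TheoremA

end X2Word

end FK

end Summit.CriticalPhenomena.PercolationContinuityZ3.Theorems
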